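import Summits.CriticalPhenomena.PercolationContinuityZ3.Theorems.PercGamblersRuinBGNOffTheFloorThreshold
import Summits.CriticalPhenomena.PercolationContinuityZ3.Theorems.PercGamblersRuinBGNOffTheFloorPlaneGluing
import HarnessLib

/-!
# `BGNOffTheFloor` (stmt-CriticalPhenomena-7773) — the line's composition as an importable split glue

Crux `Summit.CriticalPhenomena.PercolationContinuityZ3.Theses.PercGamblersRuin.BGNOffTheFloor`
(route `PercGamblersRuin`, item stmt-CriticalPhenomena-7773), line `registered` (skeleton
`Cruxes/BGNOffTheFloor/Lines/birth.lean`, dossier `Cruxes/BGNOffTheFloor/Lines/birth-dead.md`, lead c4).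

The registered skeleton composes the crux from its two open stubs,
`BGNOffTheFloor_of : stub_unitRatioBGN → stub_planeGluing → BGNOffTheFloor`, inside a non-importable
crux workfile. This file puts that composition into `Theorems/`, with both stub statements spelled
out verbatim (registered signatures), so that a planner can SPLIT the crux into the two statements
with `--glue-by Summit.CriticalPhenomena.PercolationContinuityZ3.Theorems.bgnOffTheFloor_of_unitRatioBGN_of_planeGluing`:

* `bgnOffTheFloor_of_unitRatioBGN_of_planeGluing` — `UnitRatioBGN → PlaneGluing → BGNOffTheFloor`
  (plane gluing gives the ladder step `ClimbExtension` θ-blindly, `stub_climbExtensionOfPlaneGluing`,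
  p153354; `ClimbExtension` is the implication `UnitRatioBGN → BGNOffTheFloor`,
  `OffFloor.climbExtension_iff_unit_imp`, p152651);
* `unitRatioBGN_of_bgnOffTheFloor` — the first child is NECESSARY (it is the instance `(a,b) = (1,2)`);
* `bgnOffTheFloor_iff_unitRatioBGN_of_planeGluing` — under plane gluing the crux is EQUIVALENT to
  `UnitRatioBGN` ("BGN at one positive relative depth");
* `stub_splitGlue` — the same composition under the registered stub name (STUB 8 of the skeleton).

The second child (plane gluing, the separating-plane instance of Kozma–Nitzan's Conjecture 1,
arXiv:2401.12397 p. 3) is NOT a consequence of the crux: it has content in every world.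

Notation: `E(A, L) = {ω | ∃ y, y₀ = L ∧ ω ∈ {0 ⟷ y in {z | -A < z₀}}}`, `e_n(a,b) = P_{p_c}(E(an, bn))`,
`f(A,L) = P_{p_c}(E(A,L))`; `UnitRatioBGN :≡ ∃ b₀, ∀ ε > 0, ∃ᶠ m, f(m, b₀ m) < ε`;
`PlaneGluing :≡ ∀ 1 ≤ a < b, n ≥ 1, e_n(a,b) · f((a+b) n, n) ≤ e_n(a,b+1)`.
-/

noncomputable section

namespace Summit.CriticalPhenomena.PercolationContinuityZ3.Theorems

open MeasureTheory Filter Literature.Probability.Percolation Literature.Probability.LatticeModels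

/-- **Split glue for the crux `BGNOffTheFloor`**: `UnitRatioBGN → PlaneGluing → BGNOffTheFloor`, both
hypotheses being the registered stub signatures of line `registered` verbatim. Plane gluing yields the
ladder step `ClimbExtension` (`stub_climbExtensionOfPlaneGluing`: trivial if `θ(p_c) = 0`, and in a
jump world the gluing factor is `≥ θ(p_c)/2` at every scale), and `ClimbExtension` is exactly the
implication `UnitRatioBGN → BGNOffTheFloor` (`OffFloor.climbExtension_iff_unit_imp`: one pair off the
floor, ratio monotonicity for high ceilings, downward induction on the ceiling). [folklore] -/
theorem bgnOffTheFloor_of_unitRatioBGN_of_planeGluing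
    (hunit : ∃ b₀ : ℕ, ∀ ε : ℝ, 0 < ε → ∃ᶠ m : ℕ in atTop,
      (bondPercolation (zdGraph 3) (criticalProbI 3)).real
        {ω | ∃ y : Site 3, y 0 = ((b₀ * m : ℕ) : ℤ) ∧
          ω ∈ openConnIn {z : Site 3 | -((m : ℕ) : ℤ) < z 0} 0 y} < ε)
    (hplane : ∀ a b n : ℕ, 1 ≤ a → a < b → 1 ≤ n →
      (bondPercolation (zdGraph 3) (criticalProbI 3)).real
          {ω | ∃ y : Site 3, y 0 = ((b * n : ℕ) : ℤ) ∧
            ω ∈ openConnIn {z : Site 3 | -((a * n : ℕ) : ℤ) < z 0} 0 y} *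
        (bondPercolation (zdGraph 3) (criticalProbI 3)).real
          {ω | ∃ y : Site 3, y 0 = ((n : ℕ) : ℤ) ∧
            ω ∈ openConnIn {z : Site 3 | -(((a + b) * n : ℕ) : ℤ) < z 0} 0 y} ≤
      (bondPercolation (zdGraph 3) (criticalProbI 3)).real
          {ω | ∃ y : Site 3, y 0 = (((b + 1) * n : ℕ) : ℤ) ∧
            ω ∈ openConnIn {z : Site 3 | -((a * n : ℕ) : ℤ) < z 0} 0 y}) :
    Theses.PercGamblersRuin.BGNOffTheFloor :=
  OffFloor.climbExtension_iff_unit_imp.1 (stub_climbExtensionOfPlaneGluing hplane) hunit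

/-- **The first child is necessary**: `BGNOffTheFloor → UnitRatioBGN` (the instance `(a,b) = (1,2)`
of the crux, `b₀ := 2`). [folklore] -/
theorem unitRatioBGN_of_bgnOffTheFloor (h : Theses.PercGamblersRuin.BGNOffTheFloor) :
    ∃ b₀ : ℕ, ∀ ε : ℝ, 0 < ε → ∃ᶠ m : ℕ in atTop,
      (bondPercolation (zdGraph 3) (criticalProbI 3)).real
        {ω | ∃ y : Site 3, y 0 = ((b₀ * m : ℕ) : ℤ) ∧
          ω ∈ openConnIn {z : Site 3 | -((m : ℕ) : ℤ) < z 0} 0 y} < ε :=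
  ⟨2, fun ε hε => by simpa only [one_mul] using h 1 2 one_lt_two ε hε⟩

/-- **Under plane gluing the crux is its existential shadow**:
`PlaneGluing → (BGNOffTheFloor ↔ UnitRatioBGN)`. [folklore] -/
theorem bgnOffTheFloor_iff_unitRatioBGN_of_planeGluing
    (hplane : ∀ a b n : ℕ, 1 ≤ a → a < b → 1 ≤ n →
      (bondPercolation (zdGraph 3) (criticalProbI 3)).real
          {ω | ∃ y : Site 3, y 0 = ((b * n : ℕ) : ℤ) ∧
            ω ∈ openConnIn {z : Site 3 | -((a * n : ℕ) : ℤ) < z 0} 0 y} *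
        (bondPercolation (zdGraph 3) (criticalProbI 3)).real
          {ω | ∃ y : Site 3, y 0 = ((n : ℕ) : ℤ) ∧
            ω ∈ openConnIn {z : Site 3 | -(((a + b) * n : ℕ) : ℤ) < z 0} 0 y} ≤
      (bondPercolation (zdGraph 3) (criticalProbI 3)).real
          {ω | ∃ y : Site 3, y 0 = (((b + 1) * n : ℕ) : ℤ) ∧
            ω ∈ openConnIn {z : Site 3 | -((a * n : ℕ) : ℤ) < z 0} 0 y}) :
    Theses.PercGamblersRuin.BGNOffTheFloor ↔
      ∃ b₀ : ℕ, ∀ ε : ℝ, 0 < ε → ∃ᶠ m : ℕ in atTop,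
        (bondPercolation (zdGraph 3) (criticalProbI 3)).real
          {ω | ∃ y : Site 3, y 0 = ((b₀ * m : ℕ) : ℤ) ∧
            ω ∈ openConnIn {z : Site 3 | -((m : ℕ) : ℤ) < z 0} 0 y} < ε :=
  ⟨unitRatioBGN_of_bgnOffTheFloor, fun hunit => bgnOffTheFloor_of_unitRatioBGN_of_planeGluing hunit hplane⟩

/-- **Registered STUB 8 `stub_splitGlue` of line `registered` (birth) of `BGNOffTheFloor`, signature
verbatim**: the line's composition `stub_unitRatioBGN → stub_planeGluing → BGNOffTheFloor`, by
`bgnOffTheFloor_of_unitRatioBGN_of_planeGluing`. [folklore] -/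
theorem stub_splitGlue :
    (∃ b₀ : ℕ, ∀ ε : ℝ, 0 < ε → ∃ᶠ m : ℕ in atTop,
      (bondPercolation (zdGraph 3) (criticalProbI 3)).real
        {ω | ∃ y : Site 3, y 0 = ((b₀ * m : ℕ) : ℤ) ∧
          ω ∈ openConnIn {z : Site 3 | -((m : ℕ) : ℤ) < z 0} 0 y} < ε) →
    (∀ a b n : ℕ, 1 ≤ a → a < b → 1 ≤ n →
      (bondPercolation (zdGraph 3) (criticalProbI 3)).real
          {ω | ∃ y : Site 3, y 0 = ((b * n : ℕ) : ℤ) ∧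
            ω ∈ openConnIn {z : Site 3 | -((a * n : ℕ) : ℤ) < z 0} 0 y} *
        (bondPercolation (zdGraph 3) (criticalProbI 3)).real
          {ω | ∃ y : Site 3, y 0 = ((n : ℕ) : ℤ) ∧
            ω ∈ openConnIn {z : Site 3 | -(((a + b) * n : ℕ) : ℤ) < z 0} 0 y} ≤
      (bondPercolation (zdGraph 3) (criticalProbI 3)).real
          {ω | ∃ y : Site 3, y 0 = (((b + 1) * n : ℕ) : ℤ) ∧
            ω ∈ openConnIn {z : Site 3 | -((a * n : ℕ) : ℤ) < z 0} 0 y}) →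
    Summit.CriticalPhenomena.PercolationContinuityZ3.Theses.PercGamblersRuin.BGNOffTheFloor :=
  fun hunit hplane => bgnOffTheFloor_of_unitRatioBGN_of_planeGluing hunit hplane

end Summit.CriticalPhenomena.PercolationContinuityZ3.Theorems

end
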